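import Summits.BirchSwinnertonDyer.Rank1Residual.Supersingular.RankOneKimLevelKRecordShapeX7
import Summits.BirchSwinnertonDyer.Rank1Residual.Supersingular.IntModelMinimalityKrausTwoMore
import Summits.BirchSwinnertonDyer.Rank1Residual.Supersingular.RankOneSurjThreeCertificates_12
import Summits.BirchSwinnertonDyer.Rank1Residual.Supersingular.CountPointsFastSplit
import HarnessLib

/-!
# Rank ONE at `p = 3`, `#Ш_an = 9`, `3 ∤ ∏c_ℓ`: per-pair RECORDS in the Kim-PRE level-27 currency — `BSD(E,3)` from ONE
# PRIME-level Kurihara number `δ̃_ℓ ≢ 0 (mod 27)` at a cyclic `ℓ ∈ 𝒫_3` (iw-2 ENGINE K v1.3 depth-3, population R1k3) and the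
# two-engine descent count `9 ∣ #Sel^(3)(E/ℚ)`, every side condition DECIDED in the kernel (cell `b2b-bsdres`, supersingular family
# prover B = unit `b2b-bsdres-additive-p3`, gen 23; class lead N6·O3, X7 joint B side; part X7D: 7 of 33 rows)

HONEST FRAMING (cell `b2b-bsdres-*`, verbatim): prove what is provable now; shrink each hard class to its core with data;
no claim beyond stated classes; COMBINATION classes deleted from PUBLISHED theorems only, CONSTRUCTION-shaped remainder
typed; this is not "finishing BSD". X7 / X8 stay CONSTRUCTION-SHAPED; NOT class theorems; nothing is booked; O3's / O4's marks
do not move. EVERY theorem below is CONDITIONAL on the ANNOUNCED preprint C.-H. Kim (app. R. Pollack), arXiv:2505.09121 Thm. 1.1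
(`hK25s`, OPEN binder) and takes AS BINDERS (i) the non-vanishing `kuriharaNumber D.f 27 ℓ ψ ≠ 0` of ONE level-27 Kurihara number
for a surjective `ψ_ℓ : (ℤ/ℓ)ˣ → ℤ/27` — the kernel does NOT compute that number; iw-2's ENGINE K v1.3 did (EVIDENCE:
`HOME/b2b-bsdres-iw-2/ENGINE-K-P9.md` §4 GEN 12 (D), `tables/engKp9_{pairs,levels}.tsv`; twisted `L`-values by the approximate functional
equation, certificates feq / round_resid / dft per level; ONE engine at depth 3 on these rows) — and (ii) the descent count
`9 ∣ #Sel^(3)(E/ℚ)` = gen 19's TWO-ENGINE exact 3-descent (`dim Sel₃ = 3` on both engines; x11b engine 1 / x10b engine 2, kit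
j132399+j136163+j136262 / j132400+j136164+j136263; `HOME/b2b-bsdres-additive-p3/g19/sha9core/R1SHA2-TABLE.md`). Population R1k3 =
r_an 1, X7/X8, surj(3), `v₃(∏c) + v₃(#Ш_an) = 2`, `q = 27`, `ν = 1`: 1 791 rows, 1 666 decided with `min ord₃ δ̃^{(3)} = 2` = Kim's
expected depth; the 33 rows here are the `#Ш_an = 9`, `3 ∤ ∏c` cells OPEN at engine-A ROUND 203 (gen-20 census) without a
level-27 record yet: O4@3 32, O3 1 (gen 21's `RankOneKimLevel27RecordsX8A/B` hold the other 19 O3 rows).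

WHAT THE KERNEL DECIDES PER ROW (shapes `X7RankOne/X8RankOne.bsdp_three_of_kim2025_OPEN_of_ainvs_of_kuriharaNumber_ne_zero_of_card_selmerGroup_of_countPointsFast`,
`RankOneKimLevelKRecordShapeX7.lean`, into gen 18's `RankOne.bsdp_of_kim2025_OPEN_of_casselsTate_of_kuriharaNumber_ne_zero_of_pow_dvd`,
`k = 3 ≤ 4`, `j = 1`): global minimality of the Cremona model (x11c bounded Kraus / gen-20 criterion₃), `3 ∤ Δ` and `#Ẽ(𝔽₃)` (class
X8: `∈ {1,7}`; class X7: `3 ∣ 4 − #Ẽ(𝔽₃)` plus an additive prime `q ∣ Δ, q ∣ c₄`), `ℓ ≥ 5` prime, `ℓ ∤ Δ`, `ℓ ≡ 1 (mod 27)`, the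
point count `#Ẽ(𝔽_ℓ) = n_ℓ` by prover A's `countPointsFast` (binary modular exponentiation, `decide +kernel`) with `27 ∣ n_ℓ` (so
`ℓ ∈ 𝒫_3`), CYCLICITY `#Ẽ(𝔽_ℓ)[3] ≤ 3` by the cube test `Δ^{(ℓ−1)/3} ≢ 1 (mod ℓ)` (n1011-p15); surj(3) is gen 21's kernel
certificate `surj_x7r1_/surj_x8r1_<label>_3`; the 3-adic tower needs no witness. OTHER BINDERS: `hCT`, `hGZK`, `hmod` PUBLISHED;
`D`; `r_an = 1` and `#Ш_an = q` with `ord₃ q = 2` (Cremona allbsd). READING (class lead / X7 joint B): on these rows BSD₃ holds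
modulo (Kim 2025 refereed) + (the engine's δ̃_ℓ mod 27) + (the two-engine descent count) + published facts — a SECOND conditional
route beside the gen-19/20 rem13 + descent records (tier-D composed citation `hK`). By Cassels–Tate squareness the level-27
number pins `ord₃ #Ш = 2` exactly (`≤ 2` from Kim's clause at `k = 3`, `≥ 1` from the descent bit).

References: [Kim2025RefinedTNC] Thm. 1.1 (ANNOUNCED, OPEN binder); [Kim2022StructureSelmer] §1.2.2, Thm. 1.9 (6), Conj. 1.10;
[SilvermanAEC2009] III.1, VII.1, VII.5, X.4.2, X.4.14; [IrelandRosen1990] Prop. 5.1.2; [Kraus1989]; [Cremona1997] §3.6;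
[Cremona2006] Table 1; [Miller2011LMS] Def. 1.1.
-/

set_option autoImplicit false

noncomputable section

open scoped Classical MatrixGroups ModularForm

open CongruenceSubgroup WeierstrassCurve Literature.NumberTheory.EllipticCurves
  Literature.NumberTheory.EllipticCurves.ModularForms
  Literature.NumberTheory.EllipticCurves.Rank1Residual
  Literature.NumberTheory.EllipticCurves.Rank1Residual.Typed
  Literature.NumberTheory.EllipticCurves.Rank1Residual.X11RankOneCertificates
  Summit.BirchSwinnertonDyer.BirchSwinnertonDyer.Rank1Residual.X11RankOne

namespace Summit.BirchSwinnertonDyer.Rank1Residual.Supersingular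

/-- **`381064d1`** (O4@3 = X7@3 ∧ `r_an = 1`; Cremona model `[0, 0, 0, -10823444, -13705545516]`, `N = 381064` = 2^3·19·23·109, `#Ш_an = 9`, `∏c_ℓ = 8` (`3`-unit: the expected depth is `k = ord₃ #Ш + 1 = 3`), `#E(ℚ)_tors = 1`): `BSD(E,3)` from the level-27 Kurihara number at the prime `ℓ = 5779 ∈ 𝒫_3` — KERNEL: `ℓ ≡ 1 (mod 27)`, `#Ẽ(𝔽_{5779}) = 5778` (`countPointsFast`; `a_ℓ = 2 ≡ ℓ + 1 (mod 27)`), cube test `Δ^{(ℓ−1)/3} ≡ 2851 ≢ 1 (mod 5779)` (cyclic `3`-part; engine K: `Ẽ(𝔽_ℓ) ≅ ℤ/5778`, `#Ẽ[3] = 3`), class X7 (`#Ẽ(𝔽₃) = 4`, additive at `2`), minimality, surj(3) (`surj_x7r1_381064d1_3`); BINDER `hδ`: iw-2 ENGINE K v1.3 depth-3 (population R1k3, `tables/engKp9_levels.tsv`, kit j140808; ONE engine at this level; certificates feq ≤ 3.7e-15, round_resid ≤ 5.7e-13, dft ≤ 2.9e-12, D = 1): `δ̃_ℓ ≡ 18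 (mod 27)` (tower [0, 0, 18], `ord₃ = 2 < 3`); all levels run (ℓ:δ̃ mod 27) 487:0, 5779:18. Non-vanishing mod 27 does not depend on the surjective `ψ_ℓ` (ν = 1: a change of `ψ_ℓ` multiplies `δ̃_ℓ` by a unit), so `hδ` is stated for an arbitrary surjective `ψ`. BINDER `hcard` = gen-19 TWO-ENGINE exact 3-descent `dim Sel₃ = 3` (engine 1 GRH(3sat) j136262 / engine 2 LOWERBOUND j136263, dimSha[3]=2; verdict TWO-ENGINE-LOWERBOUND(dim>=3 both; GRH(3sat) / LOWERBOUND); `HOME/b2b-bsdres-additive-p3/g19/sha9core/R1SHA2-TABLE.md`). CONDITIONAL on `hK25s` (OPEN); `hCT`/`hGZK`/`hmod` PUBLISHED; `r_an = 1`, `#Ш_an` Cremona. A SECOND conditional route on this cell beside the gen-19/20 rem13 + descent record (tier-D `hK`). Per pair; nothing booked. [claim: Kim2025RefinedTNC, status: under-review] [cite: Kim2025RefinedTNC, Thm. 1.1 (ANNOUNCED, OPEN binder)] [cite: Kim2022StructureSelmer, §1.2.2] [cite: SilvermanAEC2009, Thm. X.4.2(a) and Thm. X.4.14] [cite: Cremona2006,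 Table 1 (Cremona label 381064d1)] -/
theorem bsdp_x7r1kim27_381064d1
    (hK25s : Kim2025.thm11_kimShaLength_of_integralPeriod_OPEN)
    (hCT : exists_casselsTate_pairing (K := ℚ))
    (hGZK : rank_eq_analyticRank_of_analyticRank_le_one) (hmod : hasEntireLFunction_rat)
    (W : WeierstrassCurve ℚ) (hW : W = ⟨0, 0, 0, -10823444, -13705545516⟩) (hr : W.analyticRank = 1)
    {N : ℕ} [NeZero N] (D : ModularParametrizationData W N)
    (ψ : (ℓ'' : ℕ) → (ZMod ℓ'')ˣ →* Multiplicative (ZMod (3 ^ 3))) (hψ : Function.Surjective (ψ 5779))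
    (hδ : kuriharaNumber D.f (3 ^ 3) 5779 ψ ≠ 0)
    (hcard : 3 ^ 2 ∣ Nat.card (W.selmerGroup ((3 : ℕ) : ℤ)))
    {q : ℚ} (hq : shaAn W = (q : ℂ)) (hv : padicValRat 3 q = 2) : BSDp W 3 := by
  subst hW
  exact X7RankOne.bsdp_three_of_kim2025_OPEN_of_ainvs_of_kuriharaNumber_ne_zero_of_card_selmerGroup_of_countPointsFast
    hK25s hCT hGZK hmod 0 0 0 (-10823444) (-13705545516)
    (isGloballyMinimal_of_krausCriterion_bounded 0 0 0 (-10823444) (-13705545516)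
      (by decide +kernel) (by decide +kernel) (by decide +kernel))
    (by decide) (n₃ := 4) (by decide +kernel) (by decide) 2 (by norm_num) (by decide) (by decide)
    surj_x7r1_381064d1_3 hr D (k := 3) (by norm_num) (by norm_num)
    5779 (hℓ := ⟨by norm_num⟩) (by norm_num) (by decide) (by decide) (nℓ := 5778)
    (by decide +kernel)
    (by decide) (by decide +kernel) (by decide +kernel) ψ hψ hδ hcard hq hv

/-- **`389104b1`** (O4@3 = X7@3 ∧ `r_an = 1`; Cremona model `[0, 0, 0, -70, -561]`, `N = 389104` = 2^4·83·293, `#Ш_an = 9`, `∏c_ℓ = 2` (`3`-unit: the expected depth is `k = ord₃ #Ш + 1 = 3`), `#E(ℚ)_tors = 2`): `BSD(E,3)` from the level-27 Kurihara number at the prime `ℓ = 18199 ∈ 𝒫_3` — KERNEL: `ℓ ≡ 1 (mod 27)`, `#Ẽ(𝔽_{18199}) = 18252` (`countPointsFast` in split form, k = 9000; `a_ℓ = -52 ≡ ℓ + 1 (mod 27)`), cube test `Δ^{(ℓ−1)/3} ≡ 17180 ≢ 1 (mod 18199)` (cyclic `3`-part; engine K: `Ẽ(𝔽_ℓ) ≅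 ℤ/18252`, `#Ẽ[3] = 3`), class X7 (`#Ẽ(𝔽₃) = 4`, additive at `2`), minimality, surj(3) (`surj_x7r1_389104b1_3`); BINDER `hδ`: iw-2 ENGINE K v1.3 depth-3 (population R1k3, `tables/engKp9_levels.tsv`, kit j140818; ONE engine at this level; certificates feq ≤ 3.0e-15, round_resid ≤ 5.7e-14, dft ≤ 2.4e-13, D = 1): `δ̃_ℓ ≡ 18 (mod 27)` (tower [0, 0, 18], `ord₃ = 2 < 3`); all levels run (ℓ:δ̃ mod 27) 1567:0, 9883:0, 18199:18. Non-vanishing mod 27 does not depend on the surjective `ψ_ℓ` (ν = 1: a change of `ψ_ℓ` multiplies `δ̃_ℓ` by a unit), so `hδ` is stated for an arbitrary surjective `ψ`. BINDER `hcard` = gen-19 TWO-ENGINE exact 3-descent `dim Sel₃ = 3` (engine 1 GRH(3sat) j136262 / engine 2 LOWERBOUND j136263, dimSha[3]=2; verdict TWO-ENGINE-LOWERBOUND(dim>=3 both; GRH(3sat) / LOWERBOUND); `HOME/b2b-bsdres-additive-p3/g19/sha9core/R1SHA2-TABLE.md`). CONDITIONAL on `hK25s` (OPEN); `hCT`/`hGZK`/`hmod`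 PUBLISHED; `r_an = 1`, `#Ш_an` Cremona. A SECOND conditional route on this cell beside the gen-19/20 rem13 + descent record (tier-D `hK`). Per pair; nothing booked. [claim: Kim2025RefinedTNC, status: under-review] [cite: Kim2025RefinedTNC, Thm. 1.1 (ANNOUNCED, OPEN binder)] [cite: Kim2022StructureSelmer, §1.2.2] [cite: SilvermanAEC2009, Thm. X.4.2(a) and Thm. X.4.14] [cite: Cremona2006, Table 1 (Cremona label 389104b1)] -/
theorem bsdp_x7r1kim27_389104b1
    (hK25s : Kim2025.thm11_kimShaLength_of_integralPeriod_OPEN)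
    (hCT : exists_casselsTate_pairing (K := ℚ))
    (hGZK : rank_eq_analyticRank_of_analyticRank_le_one) (hmod : hasEntireLFunction_rat)
    (W : WeierstrassCurve ℚ) (hW : W = ⟨0, 0, 0, -70, -561⟩) (hr : W.analyticRank = 1)
    {N : ℕ} [NeZero N] (D : ModularParametrizationData W N)
    (ψ : (ℓ'' : ℕ) → (ZMod ℓ'')ˣ →* Multiplicative (ZMod (3 ^ 3))) (hψ : Function.Surjective (ψ 18199))
    (hδ : kuriharaNumber D.f (3 ^ 3) 18199 ψ ≠ 0)
    (hcard : 3 ^ 2 ∣ Nat.card (W.selmerGroup ((3 : ℕ) : ℤ)))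
    {q : ℚ} (hq : shaAn W = (q : ℂ)) (hv : padicValRat 3 q = 2) : BSDp W 3 := by
  subst hW
  exact X7RankOne.bsdp_three_of_kim2025_OPEN_of_ainvs_of_kuriharaNumber_ne_zero_of_card_selmerGroup_of_countPointsFast
    hK25s hCT hGZK hmod 0 0 0 (-70) (-561)
    (isGloballyMinimal_of_krausCriterion_bounded 0 0 0 (-70) (-561)
      (by decide +kernel) (by decide +kernel) (by decide +kernel))
    (by decide) (n₃ := 4) (by decide +kernel) (by decide) 2 (by norm_num) (by decide) (by decide)
    surj_x7r1_389104b1_3 hr D (k := 3) (by norm_num) (by norm_num)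
    18199 (hℓ := ⟨by norm_num⟩) (by norm_num) (by decide) (by decide) (nℓ := 18252)
    (countPointsFast_eq_of_split 0 0 0 (-70) (-561) 18199 9000 (by norm_num) (s₁ := 9005) (s₂ := 9246)
      (by decide +kernel) (by decide +kernel) (by norm_num))
    (by decide) (by decide +kernel) (by decide +kernel) ψ hψ hδ hcard hq hv

/-- **`389525a1`** (O4@3 = X7@3 ∧ `r_an = 1`; Cremona model `[1, -1, 0, -40567, -3134784]`, `N = 389525` = 5^2·15581, `#Ш_an = 9`, `∏c_ℓ = 2` (`3`-unit: the expected depth is `k = ord₃ #Ш + 1 = 3`), `#E(ℚ)_tors = 2`): `BSD(E,3)` from the level-27 Kurihara number at the prime `ℓ = 379 ∈ 𝒫_3` — KERNEL: `ℓ ≡ 1 (mod 27)`, `#Ẽ(𝔽_{379}) = 378` (`countPointsFast`; `a_ℓ = 2 ≡ ℓ + 1 (mod 27)`), cube test `Δ^{(ℓ−1)/3} ≡ 51 ≢ 1 (mod 379)` (cyclic `3`-part; engine K: `Ẽ(𝔽_ℓ) ≅ ℤ/378`, `#Ẽ[3] = 3`), class X7 (`#Ẽ(𝔽₃) = 4`,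 additive at `5`), minimality, surj(3) (`surj_x7r1_389525a1_3`); BINDER `hδ`: iw-2 ENGINE K v1.3 depth-3 (population R1k3, `tables/engKp9_levels.tsv`, kit j140824; ONE engine at this level; certificates feq ≤ 3.7e-15, round_resid ≤ 4.3e-14, dft ≤ 4.9e-13, D = 1): `δ̃_ℓ ≡ 9 (mod 27)` (tower [0, 0, 9], `ord₃ = 2 < 3`); all levels run (ℓ:δ̃ mod 27) 109:0, 379:9. Non-vanishing mod 27 does not depend on the surjective `ψ_ℓ` (ν = 1: a change of `ψ_ℓ` multiplies `δ̃_ℓ` by a unit), so `hδ` is stated for an arbitrary surjective `ψ`. BINDER `hcard` = gen-19 TWO-ENGINE exact 3-descent `dim Sel₃ = 3` (engine 1 GRH(3sat) j136262 / engine 2 LOWERBOUND j136263, dimSha[3]=2; verdict TWO-ENGINE-LOWERBOUND(dim>=3 both; GRH(3sat) / LOWERBOUND); `HOME/b2b-bsdres-additive-p3/g19/sha9core/R1SHA2-TABLE.md`). CONDITIONAL on `hK25s` (OPEN); `hCT`/`hGZK`/`hmod` PUBLISHED; `r_an = 1`, `#Ш_an` Cremona. A SECOND conditional route on this cell beside the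 gen-19/20 rem13 + descent record (tier-D `hK`). Per pair; nothing booked. [claim: Kim2025RefinedTNC, status: under-review] [cite: Kim2025RefinedTNC, Thm. 1.1 (ANNOUNCED, OPEN binder)] [cite: Kim2022StructureSelmer, §1.2.2] [cite: SilvermanAEC2009, Thm. X.4.2(a) and Thm. X.4.14] [cite: Cremona2006, Table 1 (Cremona label 389525a1)] -/
theorem bsdp_x7r1kim27_389525a1
    (hK25s : Kim2025.thm11_kimShaLength_of_integralPeriod_OPEN)
    (hCT : exists_casselsTate_pairing (K := ℚ))
    (hGZK : rank_eq_analyticRank_of_analyticRank_le_one) (hmod : hasEntireLFunction_rat)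
    (W : WeierstrassCurve ℚ) (hW : W = ⟨1, -1, 0, -40567, -3134784⟩) (hr : W.analyticRank = 1)
    {N : ℕ} [NeZero N] (D : ModularParametrizationData W N)
    (ψ : (ℓ'' : ℕ) → (ZMod ℓ'')ˣ →* Multiplicative (ZMod (3 ^ 3))) (hψ : Function.Surjective (ψ 379))
    (hδ : kuriharaNumber D.f (3 ^ 3) 379 ψ ≠ 0)
    (hcard : 3 ^ 2 ∣ Nat.card (W.selmerGroup ((3 : ℕ) : ℤ)))
    {q : ℚ} (hq : shaAn W = (q : ℂ)) (hv : padicValRat 3 q = 2) : BSDp W 3 := by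
  subst hW
  exact X7RankOne.bsdp_three_of_kim2025_OPEN_of_ainvs_of_kuriharaNumber_ne_zero_of_card_selmerGroup_of_countPointsFast
    hK25s hCT hGZK hmod 1 (-1) 0 (-40567) (-3134784)
    (isGloballyMinimal_of_krausCriterion_bounded 1 (-1) 0 (-40567) (-3134784)
      (by decide +kernel) (by decide +kernel) (by decide +kernel))
    (by decide) (n₃ := 4) (by decide +kernel) (by decide) 5 (by norm_num) (by decide) (by decide)
    surj_x7r1_389525a1_3 hr D (k := 3) (by norm_num) (by norm_num)
    379 (hℓ := ⟨by norm_num⟩) (by norm_num) (by decide) (by decide) (nℓ := 378)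
    (by decide +kernel)
    (by decide) (by decide +kernel) (by decide +kernel) ψ hψ hδ hcard hq hv

/-- **`403280p1`** (O4@3 = X7@3 ∧ `r_an = 1`; Cremona model `[0, 0, 0, -18969283, -32476128318]`, `N = 403280` = 2^4·5·71^2, `#Ш_an = 9`, `∏c_ℓ = 16` (`3`-unit: the expected depth is `k = ord₃ #Ш + 1 = 3`), `#E(ℚ)_tors = 2`): `BSD(E,3)` from the level-27 Kurihara number at the prime `ℓ = 4861 ∈ 𝒫_3` — KERNEL: `ℓ ≡ 1 (mod 27)`, `#Ẽ(𝔽_{4861}) = 4860` (`countPointsFast`; `a_ℓ = 2 ≡ ℓ + 1 (mod 27)`), cube test `Δ^{(ℓ−1)/3} ≡ 4541 ≢ 1 (mod 4861)` (cyclic `3`-part; engine K: `Ẽ(𝔽_ℓ) ≅ ℤ/4860`, `#Ẽ[3] = 3`), class X7 (`#Ẽ(𝔽₃) = 4`, additive at `2`), minimality, surj(3) (`surj_x7r1_403280p1_3`); BINDER `hδ`: iw-2 ENGINE K v1.3 depth-3 (population R1k3, `tables/engKp9_levels.tsv`, kit j140812; ONE engine at this level; certificates feq ≤ 2.4e-15,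 round_resid ≤ 6.8e-13, dft ≤ 5.1e-12, D = 1): `δ̃_ℓ ≡ 9 (mod 27)` (tower [0, 0, 9], `ord₃ = 2 < 3`); all levels run (ℓ:δ̃ mod 27) 4861:9, 5347:0. Non-vanishing mod 27 does not depend on the surjective `ψ_ℓ` (ν = 1: a change of `ψ_ℓ` multiplies `δ̃_ℓ` by a unit), so `hδ` is stated for an arbitrary surjective `ψ`. BINDER `hcard` = gen-19 TWO-ENGINE exact 3-descent `dim Sel₃ = 3` (engine 1 EXACT(bnfcertify1+3sat) j132399 / engine 2 EXACT(bnfcertify1+3sat) j132400, dimSha[3]=2; verdict TWO-ENGINE-EXACT-LOWER; `HOME/b2b-bsdres-additive-p3/g19/sha9core/R1SHA2-TABLE.md`). CONDITIONAL on `hK25s` (OPEN); `hCT`/`hGZK`/`hmod` PUBLISHED; `r_an = 1`, `#Ш_an` Cremona. A SECOND conditional route on this cell beside the gen-19/20 rem13 + descent record (tier-D `hK`). Per pair; nothing booked. [claim: Kim2025RefinedTNC, status: under-review] [cite: Kim2025RefinedTNC, Thm. 1.1 (ANNOUNCED, OPEN binder)] [cite: Kim2022StructureSelmer, §1.2.2]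 [cite: SilvermanAEC2009, Thm. X.4.2(a) and Thm. X.4.14] [cite: Cremona2006, Table 1 (Cremona label 403280p1)] -/
theorem bsdp_x7r1kim27_403280p1
    (hK25s : Kim2025.thm11_kimShaLength_of_integralPeriod_OPEN)
    (hCT : exists_casselsTate_pairing (K := ℚ))
    (hGZK : rank_eq_analyticRank_of_analyticRank_le_one) (hmod : hasEntireLFunction_rat)
    (W : WeierstrassCurve ℚ) (hW : W = ⟨0, 0, 0, -18969283, -32476128318⟩) (hr : W.analyticRank = 1)
    {N : ℕ} [NeZero N] (D : ModularParametrizationData W N)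
    (ψ : (ℓ'' : ℕ) → (ZMod ℓ'')ˣ →* Multiplicative (ZMod (3 ^ 3))) (hψ : Function.Surjective (ψ 4861))
    (hδ : kuriharaNumber D.f (3 ^ 3) 4861 ψ ≠ 0)
    (hcard : 3 ^ 2 ∣ Nat.card (W.selmerGroup ((3 : ℕ) : ℤ)))
    {q : ℚ} (hq : shaAn W = (q : ℂ)) (hv : padicValRat 3 q = 2) : BSDp W 3 := by
  subst hW
  exact X7RankOne.bsdp_three_of_kim2025_OPEN_of_ainvs_of_kuriharaNumber_ne_zero_of_card_selmerGroup_of_countPointsFast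
    hK25s hCT hGZK hmod 0 0 0 (-18969283) (-32476128318)
    (isGloballyMinimal_of_krausCriterion₃_bounded 0 0 0 (-18969283) (-32476128318)
      (by decide +kernel) (by decide +kernel)
      (by set_option synthInstance.maxSize 2000 in decide +kernel))
    (by decide) (n₃ := 4) (by decide +kernel) (by decide) 2 (by norm_num) (by decide) (by decide)
    surj_x7r1_403280p1_3 hr D (k := 3) (by norm_num) (by norm_num)
    4861 (hℓ := ⟨by norm_num⟩) (by norm_num) (by decide) (by decide) (nℓ := 4860)
    (by decide +kernel)
    (by decide) (by decide +kernel) (by decide +kernel) ψ hψ hδ hcard hq hv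

/-- **`404968b1`** (O4@3 = X7@3 ∧ `r_an = 1`; Cremona model `[0, 0, 0, -16874, -843675]`, `N = 404968` = 2^3·223·227, `#Ш_an = 9`, `∏c_ℓ = 2` (`3`-unit: the expected depth is `k = ord₃ #Ш + 1 = 3`), `#E(ℚ)_tors = 2`): `BSD(E,3)` from the level-27 Kurihara number at the prime `ℓ = 3079 ∈ 𝒫_3` — KERNEL: `ℓ ≡ 1 (mod 27)`, `#Ẽ(𝔽_{3079}) = 3024` (`countPointsFast`; `a_ℓ = 56 ≡ ℓ + 1 (mod 27)`), cube test `Δ^{(ℓ−1)/3} ≡ 2532 ≢ 1 (mod 3079)` (cyclic `3`-part; engine K: `Ẽ(𝔽_ℓ) ≅ ℤ/1512x2`, `#Ẽ[3] = 3`), class X7 (`#Ẽ(𝔽₃) = 4`, additive at `2`), minimality, surj(3) (`surj_x7r1_404968b1_3`); BINDER `hδ`: iw-2 ENGINE K v1.3 depth-3 (population R1k3, `tables/engKp9_levels.tsv`, kit j140811; ONE engine at this level; certificates feq ≤ 2.5e-15, round_resid ≤ 3.4e-14, dft ≤ 2.5e-13, D = 1): `δ̃_ℓ ≡ 9 (mod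 27)` (tower [0, 0, 9], `ord₃ = 2 < 3`); other non-zero levels ℓ = 4861: δ̃ ≡ 9 (mod 27); all levels run (ℓ:δ̃ mod 27) 3079:9, 4861:9. Non-vanishing mod 27 does not depend on the surjective `ψ_ℓ` (ν = 1: a change of `ψ_ℓ` multiplies `δ̃_ℓ` by a unit), so `hδ` is stated for an arbitrary surjective `ψ`. BINDER `hcard` = gen-19 TWO-ENGINE exact 3-descent `dim Sel₃ = 3` (engine 1 GRH(3sat) j136262 / engine 2 LOWERBOUND j136263, dimSha[3]=2; verdict TWO-ENGINE-LOWERBOUND(dim>=3 both; GRH(3sat) / LOWERBOUND); `HOME/b2b-bsdres-additive-p3/g19/sha9core/R1SHA2-TABLE.md`). CONDITIONAL on `hK25s` (OPEN); `hCT`/`hGZK`/`hmod` PUBLISHED; `r_an = 1`, `#Ш_an` Cremona. A SECOND conditional route on this cell beside the gen-19/20 rem13 + descent record (tier-D `hK`). Per pair; nothing booked. [claim: Kim2025RefinedTNC, status: under-review] [cite: Kim2025RefinedTNC, Thm. 1.1 (ANNOUNCED, OPEN binder)] [cite: Kim2022StructureSelmer, §1.2.2] [cite: SilvermanAEC2009,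 Thm. X.4.2(a) and Thm. X.4.14] [cite: Cremona2006, Table 1 (Cremona label 404968b1)] -/
theorem bsdp_x7r1kim27_404968b1
    (hK25s : Kim2025.thm11_kimShaLength_of_integralPeriod_OPEN)
    (hCT : exists_casselsTate_pairing (K := ℚ))
    (hGZK : rank_eq_analyticRank_of_analyticRank_le_one) (hmod : hasEntireLFunction_rat)
    (W : WeierstrassCurve ℚ) (hW : W = ⟨0, 0, 0, -16874, -843675⟩) (hr : W.analyticRank = 1)
    {N : ℕ} [NeZero N] (D : ModularParametrizationData W N)
    (ψ : (ℓ'' : ℕ) → (ZMod ℓ'')ˣ →* Multiplicative (ZMod (3 ^ 3))) (hψ : Function.Surjective (ψ 3079))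
    (hδ : kuriharaNumber D.f (3 ^ 3) 3079 ψ ≠ 0)
    (hcard : 3 ^ 2 ∣ Nat.card (W.selmerGroup ((3 : ℕ) : ℤ)))
    {q : ℚ} (hq : shaAn W = (q : ℂ)) (hv : padicValRat 3 q = 2) : BSDp W 3 := by
  subst hW
  exact X7RankOne.bsdp_three_of_kim2025_OPEN_of_ainvs_of_kuriharaNumber_ne_zero_of_card_selmerGroup_of_countPointsFast
    hK25s hCT hGZK hmod 0 0 0 (-16874) (-843675)
    (isGloballyMinimal_of_krausCriterion_bounded 0 0 0 (-16874) (-843675)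
      (by decide +kernel) (by decide +kernel) (by decide +kernel))
    (by decide) (n₃ := 4) (by decide +kernel) (by decide) 2 (by norm_num) (by decide) (by decide)
    surj_x7r1_404968b1_3 hr D (k := 3) (by norm_num) (by norm_num)
    3079 (hℓ := ⟨by norm_num⟩) (by norm_num) (by decide) (by decide) (nℓ := 3024)
    (by decide +kernel)
    (by decide) (by decide +kernel) (by decide +kernel) ψ hψ hδ hcard hq hv

/-- **`431728w1`** (O4@3 = X7@3 ∧ `r_an = 1`; Cremona model `[0, 0, 0, -863819, -389421318]`, `N = 431728` = 2^4·11^2·223, `#Ш_an = 9`, `∏c_ℓ = 4` (`3`-unit: the expected depth is `k = ord₃ #Ш + 1 = 3`), `#E(ℚ)_tors = 1`): `BSD(E,3)` from the level-27 Kurihara number at the prime `ℓ = 5563 ∈ 𝒫_3` — KERNEL: `ℓ ≡ 1 (mod 27)`, `#Ẽ(𝔽_{5563}) = 5643` (`countPointsFast`; `a_ℓ = -79 ≡ ℓ + 1 (mod 27)`), cube test `Δ^{(ℓ−1)/3} ≡ 4851 ≢ 1 (mod 5563)` (cyclic `3`-part; engine K: `Ẽ(𝔽_ℓ) ≅ ℤ/5643`,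 `#Ẽ[3] = 3`), class X7 (`#Ẽ(𝔽₃) = 4`, additive at `2`), minimality, surj(3) (`surj_x7r1_431728w1_3`); BINDER `hδ`: iw-2 ENGINE K v1.3 depth-3 (population R1k3, `tables/engKp9_levels.tsv`, kit j140827; ONE engine at this level; certificates feq ≤ 3.3e-15, round_resid ≤ 4.5e-13, dft ≤ 4.5e-12, D = 1): `δ̃_ℓ ≡ 18 (mod 27)` (tower [0, 0, 18], `ord₃ = 2 < 3`); other non-zero levels ℓ = 25111: δ̃ ≡ 9 (mod 27); all levels run (ℓ:δ̃ mod 27) 5563:18, 25111:9. Non-vanishing mod 27 does not depend on the surjective `ψ_ℓ` (ν = 1: a change of `ψ_ℓ` multiplies `δ̃_ℓ` by a unit), so `hδ` is stated for an arbitrary surjective `ψ`. BINDER `hcard` = gen-19 TWO-ENGINE exact 3-descent `dim Sel₃ = 3` (engine 1 GRH(3sat) j136262 / engine 2  j136263, ; verdict ONE-ENGINE in gen 19; TWO-ENGINE since gen 20 (engine 2 re-run kit j140402, p305738 RankOneRem13RecordsX7ShaNineE); `HOME/b2b-bsdres-additive-p3/g19/sha9core/R1SHA2-TABLE.md`). CONDITIONAL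 on `hK25s` (OPEN); `hCT`/`hGZK`/`hmod` PUBLISHED; `r_an = 1`, `#Ш_an` Cremona. A SECOND conditional route on this cell beside the gen-19/20 rem13 + descent record (tier-D `hK`). Per pair; nothing booked. [claim: Kim2025RefinedTNC, status: under-review] [cite: Kim2025RefinedTNC, Thm. 1.1 (ANNOUNCED, OPEN binder)] [cite: Kim2022StructureSelmer, §1.2.2] [cite: SilvermanAEC2009, Thm. X.4.2(a) and Thm. X.4.14] [cite: Cremona2006, Table 1 (Cremona label 431728w1)] -/
theorem bsdp_x7r1kim27_431728w1
    (hK25s : Kim2025.thm11_kimShaLength_of_integralPeriod_OPEN)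
    (hCT : exists_casselsTate_pairing (K := ℚ))
    (hGZK : rank_eq_analyticRank_of_analyticRank_le_one) (hmod : hasEntireLFunction_rat)
    (W : WeierstrassCurve ℚ) (hW : W = ⟨0, 0, 0, -863819, -389421318⟩) (hr : W.analyticRank = 1)
    {N : ℕ} [NeZero N] (D : ModularParametrizationData W N)
    (ψ : (ℓ'' : ℕ) → (ZMod ℓ'')ˣ →* Multiplicative (ZMod (3 ^ 3))) (hψ : Function.Surjective (ψ 5563))
    (hδ : kuriharaNumber D.f (3 ^ 3) 5563 ψ ≠ 0)
    (hcard : 3 ^ 2 ∣ Nat.card (W.selmerGroup ((3 : ℕ) : ℤ)))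
    {q : ℚ} (hq : shaAn W = (q : ℂ)) (hv : padicValRat 3 q = 2) : BSDp W 3 := by
  subst hW
  exact X7RankOne.bsdp_three_of_kim2025_OPEN_of_ainvs_of_kuriharaNumber_ne_zero_of_card_selmerGroup_of_countPointsFast
    hK25s hCT hGZK hmod 0 0 0 (-863819) (-389421318)
    (isGloballyMinimal_of_krausCriterion₃_bounded 0 0 0 (-863819) (-389421318)
      (by decide +kernel) (by decide +kernel)
      (by set_option synthInstance.maxSize 2000 in decide +kernel))
    (by decide) (n₃ := 4) (by decide +kernel) (by decide) 2 (by norm_num) (by decide) (by decide)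
    surj_x7r1_431728w1_3 hr D (k := 3) (by norm_num) (by norm_num)
    5563 (hℓ := ⟨by norm_num⟩) (by norm_num) (by decide) (by decide) (nℓ := 5643)
    (by decide +kernel)
    (by decide) (by decide +kernel) (by decide +kernel) ψ hψ hδ hcard hq hv

/-- **`453200bn1`** (O4@3 = X7@3 ∧ `r_an = 1`; Cremona model `[0, 0, 0, -437000, -111140625]`, `N = 453200` = 2^4·5^2·11·103, `#Ш_an = 9`, `∏c_ℓ = 8` (`3`-unit: the expected depth is `k = ord₃ #Ш + 1 = 3`), `#E(ℚ)_tors = 2`): `BSD(E,3)` from the level-27 Kurihara number at the prime `ℓ = 919 ∈ 𝒫_3` — KERNEL: `ℓ ≡ 1 (mod 27)`, `#Ẽ(𝔽_{919}) = 864` (`countPointsFast`; `a_ℓ = 56 ≡ ℓ + 1 (mod 27)`), cube test `Δ^{(ℓ−1)/3} ≡ 866 ≢ 1 (mod 919)` (cyclic `3`-part; engine K: `Ẽ(𝔽_ℓ) ≅ ℤ/432x2`, `#Ẽ[3] = 3`), class X7 (`#Ẽ(𝔽₃) = 4`, additive at `2`), minimality, surj(3) (`surj_x7r1_453200bn1_3`);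 BINDER `hδ`: iw-2 ENGINE K v1.3 depth-3 (population R1k3, `tables/engKp9_levels.tsv`, kit j140808; ONE engine at this level; certificates feq ≤ 3.0e-15, round_resid ≤ 7.5e-14, dft ≤ 8.2e-13, D = 1): `δ̃_ℓ ≡ 18 (mod 27)` (tower [0, 0, 18], `ord₃ = 2 < 3`); all levels run (ℓ:δ̃ mod 27) 919:18, 5077:0. Non-vanishing mod 27 does not depend on the surjective `ψ_ℓ` (ν = 1: a change of `ψ_ℓ` multiplies `δ̃_ℓ` by a unit), so `hδ` is stated for an arbitrary surjective `ψ`. BINDER `hcard` = gen-19 TWO-ENGINE exact 3-descent `dim Sel₃ = 3` (engine 1 GRH(3sat) j136262 / engine 2 LOWERBOUND j136263, dimSha[3]=2; verdict TWO-ENGINE-LOWERBOUND(dim>=3 both; GRH(3sat) / LOWERBOUND); `HOME/b2b-bsdres-additive-p3/g19/sha9core/R1SHA2-TABLE.md`). CONDITIONAL on `hK25s` (OPEN); `hCT`/`hGZK`/`hmod` PUBLISHED; `r_an = 1`, `#Ш_an` Cremona. A SECOND conditional route on this cell beside the gen-19/20 rem13 + descent record (tier-D `hK`). Per pair; nothing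 booked. [claim: Kim2025RefinedTNC, status: under-review] [cite: Kim2025RefinedTNC, Thm. 1.1 (ANNOUNCED, OPEN binder)] [cite: Kim2022StructureSelmer, §1.2.2] [cite: SilvermanAEC2009, Thm. X.4.2(a) and Thm. X.4.14] [cite: Cremona2006, Table 1 (Cremona label 453200bn1)] -/
theorem bsdp_x7r1kim27_453200bn1
    (hK25s : Kim2025.thm11_kimShaLength_of_integralPeriod_OPEN)
    (hCT : exists_casselsTate_pairing (K := ℚ))
    (hGZK : rank_eq_analyticRank_of_analyticRank_le_one) (hmod : hasEntireLFunction_rat)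
    (W : WeierstrassCurve ℚ) (hW : W = ⟨0, 0, 0, -437000, -111140625⟩) (hr : W.analyticRank = 1)
    {N : ℕ} [NeZero N] (D : ModularParametrizationData W N)
    (ψ : (ℓ'' : ℕ) → (ZMod ℓ'')ˣ →* Multiplicative (ZMod (3 ^ 3))) (hψ : Function.Surjective (ψ 919))
    (hδ : kuriharaNumber D.f (3 ^ 3) 919 ψ ≠ 0)
    (hcard : 3 ^ 2 ∣ Nat.card (W.selmerGroup ((3 : ℕ) : ℤ)))
    {q : ℚ} (hq : shaAn W = (q : ℂ)) (hv : padicValRat 3 q = 2) : BSDp W 3 := by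
  subst hW
  exact X7RankOne.bsdp_three_of_kim2025_OPEN_of_ainvs_of_kuriharaNumber_ne_zero_of_card_selmerGroup_of_countPointsFast
    hK25s hCT hGZK hmod 0 0 0 (-437000) (-111140625)
    (isGloballyMinimal_of_krausCriterion_bounded 0 0 0 (-437000) (-111140625)
      (by decide +kernel) (by decide +kernel) (by decide +kernel))
    (by decide) (n₃ := 4) (by decide +kernel) (by decide) 2 (by norm_num) (by decide) (by decide)
    surj_x7r1_453200bn1_3 hr D (k := 3) (by norm_num) (by norm_num)
    919 (hℓ := ⟨by norm_num⟩) (by norm_num) (by decide) (by decide) (nℓ := 864)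
    (by decide +kernel)
    (by decide) (by decide +kernel) (by decide +kernel) ψ hψ hδ hcard hq hv

end Summit.BirchSwinnertonDyer.Rank1Residual.Supersingular

end
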